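import Summits.BirchSwinnertonDyer.Rank1Residual.X11b.AnticyclotomicEulerChar
import Summits.BirchSwinnertonDyer.Rank1Residual.X11b.AnticyclotomicLinks
import HarnessLib

/-!
# X11b, route R1 — GREENBERG'S TORSION CRITERION for `X_ac^Σ(E[p^∞])`: the torsion clauses of
# erratum Thm. 1.1 and Cas18 Thm. 2.3 REDUCE to the finiteness of `H⁰(Γ, Sel_𝔭(K_∞, E[p^∞]))`

HONEST FRAMING (cell `b2b-bsdres`, run/shared/lean/b2b/bsd-rank1-residual/, verbatim in every
file): the goal of the cell is to DELETE the COMBINATION-SHAPED residual classes of the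
Birch–Swinnerton-Dyer formula for ALL analytic-rank `≤ 1` elliptic curves over `ℚ` — "full BSD
formula for every rank `≤ 1` curve in class `C`" assembled STRICTLY from published theorems — so
that the rank-`≤ 1` remainder becomes exactly the CONSTRUCTION-SHAPED classes, which are TYPED
(missing-input `Prop`s), NOT attempted. This is not "finishing BSD". Sub-cell
`b2b-bsdres-multr1-p1` (X11b, route R1 = Castella 2018 Thm. A re-proved along the author's
erratum); a RESEARCH ROUTE; no claim beyond the stated class; X11b stays CONSTRUCTION-SHAPED;
nothing here changes a label; no named fact is minted (theorems only; no `sorry`).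

## Content

Jetchev–Skinner–Wan prove the torsion clause of the anticyclotomic control theorem by one
sentence (arXiv:1512.06894 §3.3.5): "`H¹_{𝔉^Σ}(K, M)^Γ` has finite order. Hence
`X^Σ_ac(M)_Γ = Hom_𝒪(H¹_{𝔉^Σ}(K, M)^Γ, L/𝒪)` has finite order. It follows easily that `X^Σ_ac(M)` must
therefore be `Λ`-torsion." The tree has this criterion for Pontryagin dual pairs
(`IwasawaDual.IsDualPair.module_finite_and_isTorsion_of_finite_ker`: `ker ψ` finite ⇒ `X` finitely
generated AND `Λ`-torsion); `AnticyclotomicEulerChar.lean` ran it on `(X_ac^Σ, Sel_𝔭^Σ)`. This file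
names the consequences:

* `XAc.module_finite_and_isTorsion_of_finite_invariants` — for ANY `Σ` (finite or not): if
  `Sel^γ = H⁰(Γ, Sel_𝔭^Σ(K_∞, E[p^∞]))` is finite then `X_ac^Σ(E[p^∞])` is finitely generated and
  `Λ`-torsion; `XAc.isTorsion_of_finite_invariants`.
* Class level, on the constructed module: **`thm11TorsionRealAt_of_finite_invariants`** — the
  torsion clause of the erratum's Thm. 1.1 (`Thm11TorsionRealAt W p K`, OPEN/unrefereed as a whole)
  FOLLOWS from "`H⁰(Γ, Sel_𝔭(K_∞, E[p^∞]))` is finite for every anticyclotomic `κ`, generator `γ`,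
  `𝔭 ∣ p`"; **`controlTorsionAt_of_finite_invariants`** — likewise for the torsion clause of Cas18
  Thm. 2.3 (`ControlTorsionAt W p K`, PUB shape). So for route R1 the only arithmetic content of either
  torsion clause is a FINITENESS statement about the `Γ`-invariants of Castella's Selmer group (which
  JSW derive from the finiteness of `H¹_{𝔉}(K, W)` and their control computation §3.3.2–3.3.4 — not
  formalised here).

References: [JetchevSkinnerWan2017] §3.3 (arXiv:1512.06894 §3.3.5); [GreenbergLNM1716] §1 p. 60,
§4 Lemma 4.2; [Castella2018] Thm. 2.3; [Castella2018Erratum] Thm. 1.1.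
-/

noncomputable section

open scoped Classical

open WeierstrassCurve NumberField IsDedekindDomain Literature.NumberTheory.EllipticCurves
  Literature.NumberTheory.EllipticCurves.Rank1Residual
  Summit.BirchSwinnertonDyer.Rank1Residual.X11b.AcSelmer

universe u

/-! ### The criterion for `X_ac^Σ(E[p^∞])`, any `Σ` -/

namespace Summit.BirchSwinnertonDyer.Rank1Residual.X11b.AcSelmer.XAc

variable {K : Type u} [Field K] [NumberField K] (W : WeierstrassCurve K) (p : ℕ) [Fact p.Prime]
  (κ : ZpExtension K p) (𝔭 : HeightOneSpectrum (𝓞 K)) (S : Set (HeightOneSpectrum (𝓞 K)))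
  (γ : Field.absoluteGaloisGroup K) [hγ : Fact (κ.IsTopGenerator γ)]

/-- **Greenberg's criterion for `X_ac^Σ(E[p^∞])`, any `Σ`**: if `Sel^γ = {s ∈ Sel_𝔭^Σ(K_∞, E[p^∞]) |
conj_γ s = s}` is finite, then `X_ac^Σ(E[p^∞])` is a finitely generated `Λ`-torsion module (tree
`IwasawaDual.IsDualPair.module_finite_and_isTorsion_of_finite_ker` on the dual pair `XAc.isDualPair`:
Nakayama from `Sel[𝔪] ⊆ Sel^γ` finite, then `X/TX = (Sel^γ)^∨` finite forces torsion). JSW17 §3.3.5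
verbatim ("It follows easily that `X^Σ_ac(M)` must therefore be `Λ`-torsion").
[cite: JetchevSkinnerWan2017, §3.3 (arXiv:1512.06894 §3.3.5)] [cite: GreenbergLNM1716, §1 p. 60] -/
theorem module_finite_and_isTorsion_of_finite_invariants
    (hinv : Finite (IwasawaDual.endInvariants (conjSelmerAc W p κ 𝔭 S γ - 1))) :
    Module.Finite (IwasawaAlgebra p) (XAc W p κ 𝔭 S γ) ∧
      Module.IsTorsion (IwasawaAlgebra p) (XAc W p κ 𝔭 S γ) := by
  have hker : Set.Finite {s : selmerAc W p κ 𝔭 S | (conjSelmerAc W p κ 𝔭 S γ - 1) s = 0} := by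
    have e : {s : selmerAc W p κ 𝔭 S | (conjSelmerAc W p κ 𝔭 S γ - 1) s = 0} =
        (IwasawaDual.endInvariants (conjSelmerAc W p κ 𝔭 S γ - 1) : Set (selmerAc W p κ 𝔭 S)) := by
      ext s
      rw [Set.mem_setOf_eq, SetLike.mem_coe, IwasawaDual.mem_endInvariants_iff]
    rw [e]
    exact Set.toFinite _
  exact (isDualPair W p κ 𝔭 S γ).module_finite_and_isTorsion_of_finite_ker hker

/-- **`Sel^γ` finite ⇒ `X_ac^Σ(E[p^∞])` is `Λ`-torsion** (any `Σ`).
[cite: JetchevSkinnerWan2017, §3.3 (arXiv:1512.06894 §3.3.5)] [cite: GreenbergLNM1716, §1 p. 60] -/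
theorem isTorsion_of_finite_invariants
    (hinv : Finite (IwasawaDual.endInvariants (conjSelmerAc W p κ 𝔭 S γ - 1))) :
    Module.IsTorsion (IwasawaAlgebra p) (XAc W p κ 𝔭 S γ) :=
  (module_finite_and_isTorsion_of_finite_invariants W p κ 𝔭 S γ hinv).2

/-- **`Sel^γ` finite ⇒ `X_ac^Σ(E[p^∞])` is finitely generated over `Λ`** — for ANY `Σ`, with no appeal
to the unramifiedness argument of `AnticyclotomicModuleFinite.lean` (which needs `Σ` finite).
[cite: GreenbergLNM1716, §1 p. 60 (after Conj. 1.3)] -/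
theorem module_finite_of_finite_invariants
    (hinv : Finite (IwasawaDual.endInvariants (conjSelmerAc W p κ 𝔭 S γ - 1))) :
    Module.Finite (IwasawaAlgebra p) (XAc W p κ 𝔭 S γ) :=
  (module_finite_and_isTorsion_of_finite_invariants W p κ 𝔭 S γ hinv).1

end Summit.BirchSwinnertonDyer.Rank1Residual.X11b.AcSelmer.XAc

/-! ### Class level: the torsion clauses of erratum Thm. 1.1 and Cas18 Thm. 2.3 -/

namespace Summit.BirchSwinnertonDyer.Rank1Residual.X11b

variable (W : WeierstrassCurve ℚ) [W.IsGloballyMinimal] (p : ℕ) [Fact p.Prime]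
  (K : Type) [Field K] [NumberField K]

/-- **The torsion clause of the erratum's Thm. 1.1 on the constructed module follows from the
finiteness of `H⁰(Γ, Sel_𝔭(K_∞, E[p^∞]))`**: if, under the hypotheses of Thm. 1.1, for every
anticyclotomic `κ`, topological generator `γ` and prime `𝔭 ∣ p` the group
`Sel_𝔭(K_∞, E[p^∞])^γ = {s | conj_γ s = s}` is finite, then `Thm11TorsionRealAt W p K` holds (Greenberg's
criterion, `XAc.isTorsion_of_finite_invariants`). The finiteness itself is NOT proved here (it is the
content of JSW17 §3.3.2–3.3.4 / the open Thm. 1.1); this isolates what the torsion clause needs.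
[cite: Castella2018Erratum, Thm. 1.1 (p. 1), first clause] [cite: JetchevSkinnerWan2017, §3.3 (arXiv:1512.06894 §3.3.5)] -/
theorem thm11TorsionRealAt_of_finite_invariants
    (hfin : Thm11Hypotheses W p K →
      ∀ (κ : ZpExtension K p), κ.IsAnticyclotomic →
        ∀ (γ : Field.absoluteGaloisGroup K) [Fact (κ.IsTopGenerator γ)]
          (𝔭 : HeightOneSpectrum (𝓞 K)), ((p : ℕ) : 𝓞 K) ∈ 𝔭.asIdeal →
          Finite (IwasawaDual.endInvariants
            (conjSelmerAc (W.baseChange K) p κ 𝔭 ∅ γ - 1))) :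
    Thm11TorsionRealAt W p K := by
  intro h κ hκ γ _ 𝔭 h𝔭
  exact XAc.isTorsion_of_finite_invariants (W.baseChange K) p κ 𝔭 ∅ γ (hfin h κ hκ γ 𝔭 h𝔭)

omit [W.IsGloballyMinimal] in
/-- **The torsion clause of Cas18 Thm. 2.3 on the constructed module follows from the finiteness
of `H⁰(Γ, Sel_𝔭(K_∞, E[p^∞]))`** under Thm. 2.3's printed hypotheses (semistable, `p ≥ 5`, `Irr`, `K`
imaginary quadratic, `p` split, `rank E(K) = 1`, `Ш(E/K)` finite): `ControlTorsionAt W p K` from the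
finiteness of `Sel_𝔭(K_∞, E[p^∞])^γ` at every `(κ, γ, 𝔭)` — exactly the step JSW17 §3.3.5 prints. The
finiteness is NOT proved here. [cite: Castella2018, Thm. 2.3 (arXiv:1704.06608 p. 5), first clause] [cite: JetchevSkinnerWan2017, §3.3 (arXiv:1512.06894 §3.3.5)] -/
theorem controlTorsionAt_of_finite_invariants
    (hfin : Semistable W → 5 ≤ p → Irr W p → IsImaginaryQuadratic K → SplitsIn K p →
      (W.baseChange K).mordellWeilRank = 1 → (W.baseChange K).ShaFinite →
      ∀ (κ : ZpExtension K p), κ.IsAnticyclotomic →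
        ∀ (γ : Field.absoluteGaloisGroup K) [Fact (κ.IsTopGenerator γ)]
          (𝔭 : HeightOneSpectrum (𝓞 K)), ((p : ℕ) : 𝓞 K) ∈ 𝔭.asIdeal →
          Finite (IwasawaDual.endInvariants
            (conjSelmerAc (W.baseChange K) p κ 𝔭 ∅ γ - 1))) :
    ControlTorsionAt W p K := by
  intro hss hp hirr hK hsplit hrk hsha κ hκ γ _ 𝔭 h𝔭
  exact XAc.isTorsion_of_finite_invariants (W.baseChange K) p κ 𝔭 ∅ γ
    (hfin hss hp hirr hK hsplit hrk hsha κ hκ γ 𝔭 h𝔭)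

end Summit.BirchSwinnertonDyer.Rank1Residual.X11b

end
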